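import Summits.CriticalPhenomena.SAWScalingLimit.Theses.SAWExpCovariance
import Literature.Probability.RandomPlanarGeometry.SAWScalingLimitFamily
import HarnessLib

/-!
# Route `SAWExpCovariance`: the support item `CarrierDependence` (stmt-CriticalPhenomena-6758)

The support item `CarrierDependence` of route SAWExpCovariance says that a scaling-limit family
`P` of the critical `δℤ²` self-avoiding walk — a chordal family `P` that is chordal and satisfies
the convergence clause `(lim)` (for every Dobrushin domain `D` and every endpoint approximation
`a_δ, b_δ`, the critical SAW laws pushed to curves converge weakly along `δ → 0⁺` to `P D`; the
inlined body of `SAW.IsScalingLimitFamily`) — sees a Dobrushin domain only through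
`(carrier, pt 0, pt 1)`: the boundary parametrisation carried by a `DobrushinDomain` is invisible
to the lattice model.

Proof: the two hypotheses are, definitionally, `SAW.IsScalingLimitFamily P`
(`SAW.isScalingLimitFamily_iff` is `Iff.rfl`), and the tree proves
`SAW.IsScalingLimitFamily.apply_eq_of_carrier_eq` (SAWScalingLimitFamily.lean): both `P D` and
`P D'` are weak limits along the proper filter `𝓝[>] 0` of the same critical SAW laws (an
endpoint approximation of `D` exists, `SAW.exists_isEndpointApprox`, and is one of `D'`,
`SAW.IsEndpointApprox.congr`), and weak limits of probability measures are unique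
(`TendstoLaw.unique`).

## References

* G. F. Lawler, O. Schramm, W. Werner, *On the scaling limit of planar self-avoiding walk*,
  Proc. Sympos. Pure Math. 72, Part 2 (2004), 339–364, arXiv:math/0204277, §3.4.2
  [LawlerSchrammWerner2004SAW].
* P. Billingsley, *Convergence of probability measures*, 2nd ed. (1999), Thm 1.2.
-/

noncomputable section

namespace Summit.CriticalPhenomena.SAWScalingLimit.Theorems

open Summit.CriticalPhenomena.SAWScalingLimit.Theses.SAWExpCovariance

/-- **Item `CarrierDependence` (stmt-CriticalPhenomena-6758) of route SAWExpCovariance holds.**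
A chordal family `P` that is chordal and is the weak limit, along `δ → 0⁺`, of the critical
`δℤ²` SAW laws in every Dobrushin domain under every endpoint approximation satisfies
`P D = P D'` whenever `D.carrier = D'.carrier`, `D.pt 0 = D'.pt 0`, `D.pt 1 = D'.pt 1`.
The hypotheses are literally `SAW.IsScalingLimitFamily P`; conclude by
`SAW.IsScalingLimitFamily.apply_eq_of_carrier_eq` (uniqueness of weak limits along the proper
filter `𝓝[>] 0`, plus existence of endpoint approximations).
[cite: LawlerSchrammWerner2004SAW, §3.4.2] -/
theorem sawExpCovariance_carrierDependence_proof : CarrierDependence := by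
  unfold CarrierDependence
  intro P hch hlim D D' hc h0 h1
  have hP : Literature.Probability.RandomPlanarGeometry.SAW.IsScalingLimitFamily P := ⟨hch, hlim⟩
  exact hP.apply_eq_of_carrier_eq hc h0 h1

end Summit.CriticalPhenomena.SAWScalingLimit.Theorems
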